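import Literature.MathematicalPhysics.QuantumFieldTheory.Balaban1983to89.BlockAveragingEMLProp2
import Summits.QuantumFields.YangMills.Theorems.FluctuationComparisonRegPrIntLS2BetaSqrtLRecursion
import HarnessLib

/-!
# S2β · the (D-stage) REL-TEL road — BKG-TOWER: THE AVERAGED BACKGROUND's PLAQUETTES GROW GEOMETRICALLY AND NO MORE:
# `dist1 U₀(∂q) ≤ a₀` with `a₀·L^{2m}` small ⟹ `dist1 (M^t U₀)(∂p) ≤ 2·a₀·L^{2t}` at every height `t ≤ m` (print's (51) `|Ū(∂p′) − 1| < L²α₀ + C₀(L²α₀)²`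
# iterated: the quadratic corrections sum to a factor `≤ 2`) — the SIZE the relative key lemma's junk must be priced with (UV3-NODE §84.6 (3)–(4))

Cell `ym3-torus` (rung R3 = continuum `SU(2)` Yang–Mills on the three-torus — NOT d = 4, NOT infinite volume, NOT a mass gap, NOT Clay).
Width seat «width 12» `ym3-torus-px12` (gen 24); `--kind proof --supports stmt-QuantumFields-20520 --as helper`, count-neutral, DEFINITION-FREE
(0 `def`, 0 `instance`, 0 `notation`, 0 `sorry`, default heartbeats).

WHY (this seat's FINDING 13:07:55Z ∕ UV3-NODE §84.6 (3), kernel in ✓p824415∕✓p824471).  The two-tower fixed point of (D-stage) closes DEPTH-UNIFORMLY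
iff the relative key lemma's SIZE × ARC junk is priced with the BACKGROUND tower's plaquette sizes `SIZE_t ∝ θ_J·L^{2t}·L^{−2(K−J)}` (then the feedback
double sum is `O(θ_J)`), NOT with the history's thresholds `θBal(K − t)` (then `≈ θ_J·L^{(K−J)∕2}`); px10 g23's FILE 6′∕7′ and px21 g23's F4-rel B v2 now
take SIZE from the background.  The argmin `U₀`'s finest plaquettes are `≤ C₁θ_J·L^{−2(K−J)}` (BKG, px5 g22 ✓p822405 — [Balaban1985Variational] Thm 1 (9));
its AVERAGES `M^tU₀` are NOT the argmins of shorter chains, so BKG at height `t` is not ✓p822405 again — it is lit ✓`BlockAveragingEMLProp2.dist1_plaqHol_avgFun_le`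
(print's (51): `dist1 Ū(∂p′) ≤ L²a + 143·(((d+4)L)²a∕4)²`) ITERATED, with the quadratic corrections summed geometrically.  THIS FILE:
* §1 ★ `tower_le_two_mul_of_quadStep` — sequences: `0 ≤ a`, `a (t+1) ≤ L²·a t + D·(a t)²` (`t < m`), `4·D·a 0·L^{2m} ≤ L² − 1` ⟹ `a t ≤ 2·a 0·L^{2t}` (`t ≤ m`)
  (the rescaled `b_t := a_t∕L^{2t}` increases by at most `D·L^{2t−2}·b_t²`; bootstrap `b ≤ 2b₀`, telescoped against `Σ L^{2s} ≤ L^{2m}∕(L²−1)`).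
* §2 ★★★ `dist1_plaqHol_iter_le` — `SU(N)`, any `Params`, heights `t ≤ m`: `dist1 U₀(∂q) ≤ a₀` (`0 ≤ a₀`), `4·(143G²)·a₀·L^{2m} ≤ L² − 1` and the
  `ℰp` guard `G·(2a₀L^{2m}) ≤ δ_N∕2` (`G := ((d+4)L)²∕4`) ⟹ **`dist1 (M^tU₀)(∂p) ≤ 2·a₀·L^{2t}`** for every `t ≤ m`, every plaquette — BKG-TOWER with the explicit
  factor `2`; in the T³ reading `a₀ := C₁θ_J·L^{−2(K−J)}` (✓p822405) both smallness guards are `θ_J ≤ c(L)`, i.e. `γ ≤ γ₁` — NOT threaded here.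

HONEST SCOPE.  An iteration of a landed one-step estimate + sequence algebra; nothing of Bałaban's analysis beyond the cited one-step bound is asserted
([Balaban1985Averaging] Prop. 1 (51) p.26; [Balaban1985Variational] Thm 1 (9) p.279 is where `a₀` comes from); the T³ threading (`γ₁`), the relative key
lemma, (H♭♭), (D-stage), GAP♯∘ (`stub_uniformFibreGapOrbit`), S2β, crux 20520 and `YM3TorusSU2` are NOT proved; no registered stub is closed; rung R3 = SU(2)
YM₃ on T³ — NOT d = 4, NOT infinite volume, NOT a mass gap, NOT Clay; the Yang–Mills mass gap is NOT proved.
-/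

set_option autoImplicit false

noncomputable section

namespace Summit.QuantumFields.YangMills.Theorems.FluctuationComparisonRegPrIntLS2BetaBackgroundTower

open Finset
open Literature.MathematicalPhysics.QuantumFieldTheory.Balaban1983to89
open T4Continuum BlockAveraging ExpMeanLog
open Literature.MathematicalPhysics.QuantumFieldTheory.Balaban1983to89.BlockAveragingEMLProp2 (dist1_plaqHol_avgFun_le)
open Summit.QuantumFields.YangMills.Theorems.FluctuationComparisonRegPrIntLS2BetaSqrtLRecursion (geom_sum_le_pow_div)

/-! ## §1 Sequences: a quadratically perturbed geometric growth stays within a factor `2` -/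

/-- ★ **QUADRATICALLY PERTURBED GEOMETRIC GROWTH**: `0 ≤ a`, `a (t+1) ≤ L²·a t + D·(a t)²` for `t < m` (`1 < L`, `0 ≤ D`), and `4·D·a 0·L^{2m} ≤ L² − 1`
⟹ `a t ≤ 2·a 0·L^{2t}` for every `t ≤ m`. [folklore] -/
theorem tower_le_two_mul_of_quadStep (L D : ℝ) (hL : 1 < L) (hD : 0 ≤ D) (a : ℕ → ℝ) (m : ℕ) (ha0 : ∀ t, 0 ≤ a t)
    (hstep : ∀ t, t < m → a (t + 1) ≤ L ^ 2 * a t + D * a t ^ 2) (hsmall : 4 * D * a 0 * L ^ (2 * m) ≤ L ^ 2 - 1) :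
    ∀ t, t ≤ m → a t ≤ 2 * a 0 * L ^ (2 * t) := by
  have hL0 : 0 < L := by linarith
  have hL2 : 1 < L ^ 2 := by nlinarith
  have hL21 : 0 < L ^ 2 - 1 := by linarith
  -- the rescaled sequence `b t := a t / L^{2t}` and its increments
  set b : ℕ → ℝ := fun t => a t / L ^ (2 * t) with hb
  have hbpos : ∀ t, 0 ≤ b t := fun t => div_nonneg (ha0 t) (pow_nonneg hL0.le _)
  have hab : ∀ t, a t = b t * L ^ (2 * t) := fun t => by
    simp only [hb]; rw [div_mul_cancel₀ _ (pow_ne_zero _ hL0.ne')]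
  have hb0 : b 0 = a 0 := by simp [hb]
  have hinc : ∀ t, t < m → b (t + 1) ≤ b t + D * L ^ (2 * t) / L ^ 2 * b t ^ 2 := by
    intro t ht
    have h := hstep t ht
    rw [hab t, hab (t + 1)] at h
    have hp : L ^ (2 * (t + 1)) = L ^ (2 * t) * L ^ 2 := by rw [show 2 * (t + 1) = 2 * t + 2 by ring, pow_add]
    rw [hp] at h
    have hLt : 0 < L ^ (2 * t) := pow_pos hL0 _
    have hL2p : 0 < L ^ 2 := pow_pos hL0 2
    -- divide `h` by `L^{2t}·L²`
    have h' : b (t + 1) * (L ^ (2 * t) * L ^ 2) ≤ (b t + D * L ^ (2 * t) / L ^ 2 * b t ^ 2) * (L ^ (2 * t) * L ^ 2) := by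
      calc b (t + 1) * (L ^ (2 * t) * L ^ 2) ≤ L ^ 2 * (b t * L ^ (2 * t)) + D * (b t * L ^ (2 * t)) ^ 2 := h
        _ = (b t + D * L ^ (2 * t) / L ^ 2 * b t ^ 2) * (L ^ (2 * t) * L ^ 2) := by field_simp
    exact le_of_mul_le_mul_right h' (mul_pos hLt hL2p)
  -- bootstrap: `∀ s ≤ t, b s ≤ 2 b 0` by induction on `t ≤ m`, telescoping the increments
  have hgeom : ∀ t, t ≤ m → ∑ s ∈ range t, L ^ (2 * s) ≤ L ^ (2 * m) / (L ^ 2 - 1) := by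
    intro t ht
    have h1 : ∑ s ∈ range t, L ^ (2 * s) = ∑ s ∈ range t, (L ^ 2) ^ s := sum_congr rfl fun s _ => by rw [pow_mul]
    rw [h1]
    refine (geom_sum_le_pow_div (L ^ 2) hL2 t).trans ?_
    rw [← pow_mul]
    exact div_le_div_of_nonneg_right (pow_le_pow_right₀ hL.le (by omega)) hL21.le
  suffices hmain : ∀ t, t ≤ m → ∀ s, s ≤ t → b s ≤ 2 * b 0 by
    intro t ht
    have h := hmain t ht t le_rfl
    rw [hab t, hb0] at *
    exact mul_le_mul_of_nonneg_right h (pow_nonneg hL0.le _)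
  intro t
  induction t with
  | zero =>
    intro _ s hs
    have : s = 0 := by omega
    subst this
    linarith [hbpos 0]
  | succ t ih =>
    intro ht s hs
    rcases Nat.lt_or_ge s (t + 1) with hs' | hs'
    · exact ih (by omega) s (by omega)
    · have hs1 : s = t + 1 := le_antisymm hs hs'
      subst hs1
      -- telescope: `b (t+1) ≤ b 0 + Σ_{u ≤ t} D·L^{2u}/L²·(2 b 0)²`
      have htel : ∀ k, k ≤ t + 1 → b k ≤ b 0 + ∑ u ∈ range k, D * L ^ (2 * u) / L ^ 2 * (2 * b 0) ^ 2 := by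
        intro k
        induction k with
        | zero => intro _; simp
        | succ k ihk =>
          intro hk
          have hk' : k < m := by omega
          have hbk : b k ≤ 2 * b 0 := ih (by omega) k (by omega)
          have hsq : b k ^ 2 ≤ (2 * b 0) ^ 2 := pow_le_pow_left₀ (hbpos k) hbk 2
          have hcoef : 0 ≤ D * L ^ (2 * k) / L ^ 2 := by positivity
          calc b (k + 1) ≤ b k + D * L ^ (2 * k) / L ^ 2 * b k ^ 2 := hinc k hk'
            _ ≤ (b 0 + ∑ u ∈ range k, D * L ^ (2 * u) / L ^ 2 * (2 * b 0) ^ 2) + D * L ^ (2 * k) / L ^ 2 * (2 * b 0) ^ 2 :=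
                add_le_add (ihk (by omega)) (mul_le_mul_of_nonneg_left hsq hcoef)
            _ = b 0 + ∑ u ∈ range (k + 1), D * L ^ (2 * u) / L ^ 2 * (2 * b 0) ^ 2 := by rw [sum_range_succ]; ring
      have hsum : ∑ u ∈ range (t + 1), D * L ^ (2 * u) / L ^ 2 * (2 * b 0) ^ 2 =
          4 * D * b 0 ^ 2 / L ^ 2 * ∑ u ∈ range (t + 1), L ^ (2 * u) := by
        rw [mul_sum]; exact sum_congr rfl fun u _ => by ring
      have hS := hgeom (t + 1) ht
      have hL2p : 0 < L ^ 2 := pow_pos hL0 2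
      have hfin : 4 * D * b 0 ^ 2 / L ^ 2 * ∑ u ∈ range (t + 1), L ^ (2 * u) ≤ b 0 := by
        have h1 : 4 * D * b 0 ^ 2 / L ^ 2 * ∑ u ∈ range (t + 1), L ^ (2 * u) ≤ 4 * D * b 0 ^ 2 / L ^ 2 * (L ^ (2 * m) / (L ^ 2 - 1)) :=
          mul_le_mul_of_nonneg_left hS (by positivity)
        have h2 : 4 * D * b 0 ^ 2 / L ^ 2 * (L ^ (2 * m) / (L ^ 2 - 1)) = b 0 * ((4 * D * b 0 * L ^ (2 * m)) / (L ^ 2 - 1)) / L ^ 2 := by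
          field_simp
        have h3 : (4 * D * b 0 * L ^ (2 * m)) / (L ^ 2 - 1) ≤ 1 := by
          rw [div_le_one hL21, hb0]; exact hsmall
        have h4 : b 0 * ((4 * D * b 0 * L ^ (2 * m)) / (L ^ 2 - 1)) / L ^ 2 ≤ b 0 * 1 / L ^ 2 :=
          div_le_div_of_nonneg_right (mul_le_mul_of_nonneg_left h3 (hbpos 0)) hL2p.le
        have h5 : b 0 * 1 / L ^ 2 ≤ b 0 := by
          rw [mul_one, div_le_iff₀ hL2p]; nlinarith [hbpos 0]
        linarith
      linarith [htel (t + 1) le_rfl]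

/-! ## §2 The T³∕SU(N) reading: the averaged background's plaquettes -/

variable {n : Type*} [Fintype n] [DecidableEq n] [Nonempty n] {P : Params}

/-- ★★★ **BKG-TOWER**: if every finest plaquette of `U₀` is within `a₀` of `1` (`0 ≤ a₀`), `4·(143G²)·a₀·L^{2m} ≤ L² − 1` and `G·(2a₀L^{2m}) ≤ δ_N∕2`
(`G := ((d+4)L)²∕4`, the `ℰp` guard), then every plaquette of the `t`-fold (0.4)∕`exp[mean log]` average `M^tU₀` is within `2·a₀·L^{2t}` of `1`, for all
`t ≤ m` — print's (51) iterated, the quadratic corrections summed. [cite: Balaban1985Averaging, Prop. 1 (51) p.26] -/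
theorem dist1_plaqHol_iter_le {m : ℕ} (hL : 1 < (P.L : ℝ))
    (U₀ : GaugeField P 0 (Matrix.specialUnitaryGroup n ℂ)) {a₀ : ℝ} (ha₀ : 0 ≤ a₀)
    (hU₀ : ∀ q : Plaq P 0, dist1 (GaugeField.plaqHol U₀ q) ≤ a₀)
    (hsmall : 4 * (143 * ((((P.d + 4) * P.L : ℕ) : ℝ) ^ 2 / 4) ^ 2) * a₀ * (P.L : ℝ) ^ (2 * m) ≤ (P.L : ℝ) ^ 2 - 1)
    (hguard : ((((P.d + 4) * P.L : ℕ) : ℝ) ^ 2 / 4) * (2 * a₀ * (P.L : ℝ) ^ (2 * m)) ≤ deltaSU n / 2) :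
    ∀ t, t ≤ m → ∀ p : Plaq P t,
      dist1 (GaugeField.plaqHol (Averaging.iter (fun k => blockAvg (P := P) (j := k) (expMeanLogSU (n := n))) t U₀) p) ≤ 2 * a₀ * (P.L : ℝ) ^ (2 * t) := by
  have hL0 : (0 : ℝ) < P.L := by linarith
  set G : ℝ := (((P.d + 4) * P.L : ℕ) : ℝ) ^ 2 / 4 with hG
  have hG0 : 0 ≤ G := by positivity
  -- the bound sequence `A`: `A 0 = a₀`, `A (t+1) = L²·A t + 143G²·(A t)²`
  let A : ℕ → ℝ := fun t => Nat.rec a₀ (fun _ x => (P.L : ℝ) ^ 2 * x + 143 * G ^ 2 * x ^ 2) t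
  have hA0 : A 0 = a₀ := rfl
  have hAs : ∀ t, A (t + 1) = (P.L : ℝ) ^ 2 * A t + 143 * G ^ 2 * A t ^ 2 := fun t => rfl
  have hApos : ∀ t, 0 ≤ A t := by
    intro t; induction t with
    | zero => exact ha₀
    | succ t ih => rw [hAs]; positivity
  -- §1: `A t ≤ 2 a₀ L^{2t}` for `t ≤ m`
  have hAle : ∀ t, t ≤ m → A t ≤ 2 * a₀ * (P.L : ℝ) ^ (2 * t) := by
    have h := tower_le_two_mul_of_quadStep (P.L : ℝ) (143 * G ^ 2) hL (by positivity) A m hApos (fun t _ => (hAs t).le)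
      (by rw [hA0]; exact hsmall)
    intro t ht; have := h t ht; rwa [hA0] at this
  -- the guard at every level below `m`
  have hAg : ∀ t, t < m → G * A t ≤ deltaSU n / 2 := by
    intro t ht
    have h1 : A t ≤ 2 * a₀ * (P.L : ℝ) ^ (2 * m) :=
      (hAle t ht.le).trans (mul_le_mul_of_nonneg_left (pow_le_pow_right₀ hL.le (by omega)) (by positivity))
    exact (mul_le_mul_of_nonneg_left h1 hG0).trans hguard
  -- induction along the tower: every plaquette of `M^tU₀` is within `A t` of `1`
  have hmain : ∀ t, t ≤ m → ∀ p : Plaq P t,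
      dist1 (GaugeField.plaqHol (Averaging.iter (fun k => blockAvg (P := P) (j := k) (expMeanLogSU (n := n))) t U₀) p) ≤ A t := by
    intro t
    induction t with
    | zero => intro _ p; exact hU₀ p
    | succ t ih =>
      intro ht p
      have ht' : t < m := by omega
      have hprev := ih (by omega)
      have h := dist1_plaqHol_avgFun_le (hApos t) hprev (by rw [← hG]; exact hAg t ht') p
      rw [hAs]
      calc dist1 (GaugeField.plaqHol (Averaging.iter (fun k => blockAvg (P := P) (j := k) (expMeanLogSU (n := n))) (t + 1) U₀) p)
          ≤ (P.L : ℝ) ^ 2 * A t + 143 * ((((P.d + 4) * P.L : ℕ) : ℝ) ^ 2 / 4 * A t) ^ 2 := h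
        _ = (P.L : ℝ) ^ 2 * A t + 143 * G ^ 2 * A t ^ 2 := by rw [hG]; ring
  intro t ht p
  exact (hmain t ht p).trans (hAle t ht)

end Summit.QuantumFields.YangMills.Theorems.FluctuationComparisonRegPrIntLS2BetaBackgroundTower

end
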